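/-
Copyright (c) 2026. Released under the Apache 2.0 license.
-/
import Literature.NumberTheory.EllipticCurves.ModularCurveManinConstantProofs
import HarnessLib

/-!
# The Manin constant divides the modular degree, prime by prime
# (Česnavičius–Neururer–Saha, JEMS 26 (2024), Thm. 1.2)

Named fact (statement only, `def … : Prop`, no `_holds`), a fifth child next to
`ManinConstantSemistablePrimewise.lean` (Mazur 1978 Cor. 4.1, Abbes–Ullmo 1996 Thm. A, Česnavičius
2018 Thm. 1.2) and `ManinConstantNonPotentiallyOrdinaryPrimes.lean` (Edixhoven 1991 Thm. 3). Unlike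
those four, this one constrains the Manin constant of an ARBITRARY modular parametrisation by
`X₀(N)` — optimal or not — at EVERY prime `p ≥ 5` (and at `2`, `3` outside two printed exceptional
clauses), by the `p`-part of its modular degree.

THE PRINTED THEOREM (K. Česnavičius, M. Neururer, A. Saha, *The Manin constant and the modular
degree*, J. Eur. Math. Soc. 26 (2024), no. 2, 573–637, doi:10.4171/jems/1367 — published; held text
`paper:arxiv-1911.09446` = arXiv v3, §1, chunk p0003 L41–68, theorem label `thm:main-result`, the
second theorem of the Introduction = Thm. 1.2; the first, label `X1N-main` = Thm. 1.1, is the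
`X₁(N)` case `c_φ ∣ deg φ`), verbatim:
"For an elliptic curve `E` over `ℚ` of conductor `N`, and for a level `Γ` with
`Γ₁(N) ⊂ Γ ⊂ Γ₀(N)`, every surjection `φ : (X_Γ)_ℚ ↠ E` satisfies `c_φ ∣ 6 · deg(φ)`, and if `N` is
cube-free that is, if `8 ∤ N` and `27 ∤ N`, then even `c_φ ∣ deg(φ)`; more precisely, for every
prime `p`, we have `val_p(c_φ) ≤ val_p(deg(φ)) + {1 if p = 2 with val_2(N) ≥ 3 and there is no
p' ∣ N with p' ≡ 3 mod 4; 1 if p = 3 with val_3(N) ≥ 3 and there is no p' ∣ N with p' ≡ 2 mod 3;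
0 otherwise}, and, more generally, if for some `Γ ⊆ Γ' ⊆ Γ₀(N)` the singularities of
`(X_{Γ'})_{ℤ_(p)}` are rational, then `val_p(c_φ) ≤ val_p(deg(φ))`."
Here (op. cit. §1, p0003 L21–27) `c_φ ∈ ℚ^×` is defined for ANY surjection `φ` by
`φ^*(ω_E) = c_φ · ω_f`, `ω_E` a Néron differential of `E` and `ω_f` the differential of the
normalised newform `f` of `E` (for `Γ = Γ₀(N)`: `ω_f = 2πi f(τ) dτ = f(q) dq/q`); `c_φ ∈ ℤ`
(Gabber / Edixhoven 1991 Prop. 2); "`φ` determines only `±c_φ`".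

RENDERING (print-faithful and WEAKER than print). Only the row "0 otherwise" of the "more
precisely" clause and only the level `Γ = Γ₀(N)` are transcribed: for every globally minimal model
`W/ℚ` of an elliptic curve `E` and every parametrisation datum `D : ModularParametrizationData W N`
AT THE CONDUCTOR LEVEL `N = N(E)` (`W.conductorNorm ℤ`; the tree's datum of
`Literature/NumberTheory/EllipticCurves/ModularCurve.lean`: the newform `f` of `W`, the Néron
lattice `Λ_E` of the model `W`, an integer `c` with `c Λ_f ⊆ Λ_E`, and the modular degree `deg` =
the generic fibre cardinality of `φ_D(τ) = uniformize (c · 2πi ∫_{i∞}^τ f)` on `Y₀(N)`), and every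
prime `p` outside the two printed exceptional clauses — NOT (`p = 2`, `2³ ∣ N`, no prime
`p' ∣ N` with `p' ≡ 3 mod 4`) and NOT (`p = 3`, `3³ ∣ N`, no prime `p' ∣ N` with `p' ≡ 2 mod 3`)
(`p'` ranges over primes, as the notation `p'` indicates; `val_p(N) ≥ 3` ↦ `p³ ∣ N`) —:
`val_p(c) ≤ val_p(deg)`; so at every `p ≥ 5` unconditionally
(`padicVal_maninConstant_le_modularDegree_of_five_le`). Why the datum is an instance of the
printed hypothesis:
`φ_D` is the composite of the standard map `π_f : X₀(N) → ℂ/Λ_f = E_f` (the optimal quotient,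
defined over `ℚ`, `∞ ↦ O`) with the isogeny `m_c : ℂ/Λ_f → ℂ/Λ_E`, `z ↦ c z`; since `c` is REAL
(an integer) and both period lattices are those of models over `ℚ ⊂ ℝ`, `m_c` commutes with complex
conjugation, hence is a `ℚ`-rational isogeny `E_f → E` (the curves `E_f`, `E` are `ℚ`-isogenous by
Faltings, `a_n(f) = a_n(E)`; `Gal(ℚ̄/ℚ)` acts on `Hom_{ℚ̄}(E_f, E) ⊗ ℚ` trivially in the non-CM case
and through `Gal(K/ℚ) = ⟨conjugation|_K⟩` in the CM case, so a conjugation-fixed homomorphism is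
`ℚ`-rational in both cases). Thus `φ_D : X₀(N)_ℚ ↠ E` is a surjection over `ℚ` of degree
`deg φ_D = D.deg` (separable, characteristic `0`: the generic fibre has exactly `deg φ_D` points,
which is the datum's `deg_spec`), and `φ_D^*(ω_W) = c · 2πi f(τ) dτ` for the invariant differential
`ω_W = dx/(2y + a₁x + a₃)` of `W` (under `uniformize`, `x = ℘ − b₂/12`, `2y + a₁x + a₃ = ℘'`, so
`ω_W` pulls back to `dz`), which IS a Néron differential because `W` is globally minimal. Hence
`c_{φ_D} = ±D.c` and the printed "0 otherwise" row gives `val_p(D.c) ≤ val_p(D.deg)` (for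
`p ≥ 5` neither exceptional clause can apply). NOT transcribed by THIS fact: the `X₁(N)` theorem
(Thm. 1.1), the `+1` rows at `p ∈ {2, 3}` (inside the exceptional clauses nothing is asserted), the
`c_φ ∣ 6·deg φ` and cube-free summaries (consequences), intermediate levels `Γ`, and the
rational-singularity refinement. The last section of this file (`cesnaviciusNeururerSaha_thm_1_2`)
transcribes the FULL clause at `Γ = Γ₀(N)` — all primes, the `+1` rows as the printed correction
term `cesnaviciusNeururerSahaCorrection` — with the bridge to this fact and the two printed
summaries `c ∣ 6 · deg`, cube-free `⇒ c ∣ deg` as proved corollaries. `D.c ≠ 0` is a tree theorem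
(`ModularParametrizationData.maninConstant_ne_zero_holds`), so the valuation statement is the
printed one (no degenerate case).

USE (cell `b2b-bsdres`, class X12 and the additive classes): the upper-half / Kolyvagin-type
theorems of `Summits/BirchSwinnertonDyer/Rank1Residual/…` carry a Manin datum `p ∤ c(D)`; at
`p ≥ 11` Edixhoven's Thm. 3 discharges it for the strong curve outside the potentially ordinary
types II–IV, and Agashe–Ribet–Stein 2006 Thm. 2.6 (Cremona) for optimal curves of conductor
`≤ 130000`; THIS fact discharges it at every `p ≥ 5` and every conductor from ONE exact class
integer — the modular degree of ANY member's parametrisation — with NO optimality hypothesis: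
`p ∤ deg φ ⟹ p ∤ c_φ` (`not_dvd_maninConstant_of_not_dvd_modularDegree` below; consumer
`Summits/BirchSwinnertonDyer/Rank1Residual/X12/InertCoreEveryCurveDegree.lean`).

PROVENANCE CAVEAT on the degree DATA (about tables, not about the theorem). Cremona's ecdata column
`alldegphi` is, above `N ≈ 14000`, the output of Watkins's program `sympow` (J. E. Cremona, *The
elliptic curve database for conductors to 130000*, ANTS-VII, LNCS 4076 (2006), §2.4 p. 17: "This
method of computing the modular degree (described in [25]) is very much more efficient than the
original one described in [8], which we stopped using at around N = 14000", §3.6 p. 25; ecdata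
`doc/manin.txt`, Additional remark 2), and that method computes `deg φ / c²`, NOT `deg φ`
(M. Watkins, *Computing the modular degree of an elliptic curve*, Experiment. Math. 11 (2002)
487–502, formula (1-1) p. 488 `L(Sym² E, 2)/(πiΩ) = deg φ/(N c²) · ∏_{p ∣ N} U_p(2)`, p. 489 "The
main downside of our algorithm is that we need to know the Manin constant", p. 490 "assuming both
the Manin and Stevens conjectures, we are able to compute the modular degree of any elliptic
curve"); the table records it as `deg φ` under the ASSUMPTION `c = 1`. PARI/GP's `ellmoddegree`
likewise returns "the modular degree of e divided by the square of the Manin constant".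
Consequently, on an isogeny class whose `X₀(N)`-optimal curve and Manin constant are NOT
independently determined (Cremona `opt_man` optimality code `≥ 2`; all such classes have
`N > 400000`), reading
`p ∤ alldegphi` as `p ∤ deg φ` presupposes `p ∤ c`, and this fact then yields only the vacuous
`val_p(c) ≤ val_p(alldegphi) + 2·val_p(c)`: such a table value does NOT instantiate the hypothesis
`hdeg : ¬ p ∣ D.modularDegree` of the corollaries below for the purpose of bounding `c`. An exact,
Manin-free modular degree (the full modular-symbol space at level `N`: Cremona, Math. Comp. 64
(1995) 1235–1250; Kohel–Stein) does, and on classes where `c = 1` is independently established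
(`opt_man` code `1`) the table value is the degree up to the analytic rounding.

## References
* [CesnaviciusNeururerSaha2023] K. Česnavičius, M. Neururer, A. Saha, *The Manin constant and the
  modular degree*, J. Eur. Math. Soc. 26 (2024), no. 2, 573–637 (online 2023),
  doi:10.4171/jems/1367; arXiv:1911.09446, Thm. 1.2 (`thm:main-result`) and §1.
* [EdixhovenManin1991] B. Edixhoven, *On the Manin constants of modular elliptic curves*, Progr.
  Math. 89 (1991) 25–39, §1, Prop. 2 (`c ∈ ℤ`, built into the datum).
* J. E. Cremona, *Algorithms for modular elliptic curves*, 2nd ed. (1997), §2.10 (`φ`, `c`, `deg`).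
* J. E. Cremona, *The elliptic curve database for conductors to 130000*, ANTS-VII, Lecture Notes in
  Comput. Sci. 4076 (2006) 11–29, §2.4, §3.6 (provenance of the degree data).
* M. Watkins, *Computing the modular degree of an elliptic curve*, Experiment. Math. 11 (2002),
  no. 4, 487–502, doi:10.1080/10586458.2002.10504701, (1-1) and §1 p. 489–490 (`deg φ / c²`).
-/

noncomputable section

open scoped MatrixGroups ModularForm

open CongruenceSubgroup UpperHalfPlane WeierstrassCurve

namespace Literature.NumberTheory.EllipticCurves.ModularForms

/-- **Česnavičius–Neururer–Saha 2024, Thm. 1.2, the "more precisely" clause for `Γ = Γ₀(N)` (the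
Manin constant divides the modular degree, prime by prime).** Printed (JEMS 26 (2024) 573–637,
Thm. 1.2; arXiv:1911.09446 §1): "For an elliptic curve `E` over `ℚ` of conductor `N`, and for a
level `Γ` with `Γ₁(N) ⊂ Γ ⊂ Γ₀(N)`, every surjection `φ : (X_Γ)_ℚ ↠ E` satisfies
`c_φ ∣ 6 · deg(φ)` … more precisely, for every prime `p`, we have `val_p(c_φ) ≤ val_p(deg(φ)) +
{1 if p = 2 with val_2(N) ≥ 3 and there is no p' ∣ N with p' ≡ 3 mod 4; 1 if p = 3 with
val_3(N) ≥ 3 and there is no p' ∣ N with p' ≡ 2 mod 3; 0 otherwise}". Rendering (see the module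
docstring; weaker than print — only the row "`0` otherwise" is transcribed, as its two printed
negated conditions): for every globally minimal model `W/ℚ` of an elliptic curve with conductor
`N = W.conductorNorm ℤ`, every parametrisation datum `D` at the conductor level — whose
`φ_D = m_c ∘ π_f : X₀(N)_ℚ ↠ E` is a surjection over `ℚ` of degree `D.deg` with
`φ_D^* ω_W = c · 2πi f(τ)dτ`, `ω_W` the Néron differential of the minimal model, so `c_{φ_D} = ±D.c`
— and every prime `p` which is NOT (`p = 2` with `2³ ∣ N` and no prime `p' ∣ N`, `p' ≡ 3 mod 4`)
and NOT (`p = 3` with `3³ ∣ N` and no prime `p' ∣ N`, `p' ≡ 2 mod 3`): `val_p(c) ≤ val_p(deg)`.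
In particular at every `p ≥ 5` unconditionally (`…_of_five_le`). Optimality is NOT assumed (this
is the point of the theorem). Named fact (statement only).
[cite: CesnaviciusNeururerSaha2023, Thm. 1.2] -/
def cesnaviciusNeururerSaha_padicVal_maninConstant_le_modularDegree : Prop :=
  ∀ (W : WeierstrassCurve ℚ) [W.IsElliptic] [W.IsGloballyMinimal] [NeZero (W.conductorNorm ℤ)]
    (D : ModularParametrizationData W (W.conductorNorm ℤ)) (p : ℕ), p.Prime →
    ¬ (p = 2 ∧ 2 ^ 3 ∣ W.conductorNorm ℤ ∧
        ∀ q : ℕ, q.Prime → q ∣ W.conductorNorm ℤ → q % 4 ≠ 3) →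
    ¬ (p = 3 ∧ 3 ^ 3 ∣ W.conductorNorm ℤ ∧
        ∀ q : ℕ, q.Prime → q ∣ W.conductorNorm ℤ → q % 3 ≠ 2) →
    padicValInt p D.maninConstant ≤ padicValNat p D.modularDegree

/-- **The row "`0` otherwise" at `p ≥ 5`**: under the fact, for every datum `D` of a globally
minimal `W` at the conductor level and every prime `p ≥ 5`, `val_p(c) ≤ val_p(deg)` (neither
printed exceptional clause can apply). [cite: CesnaviciusNeururerSaha2023, Thm. 1.2] -/
theorem padicVal_maninConstant_le_modularDegree_of_five_le
    (h : cesnaviciusNeururerSaha_padicVal_maninConstant_le_modularDegree)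
    (W : WeierstrassCurve ℚ) [W.IsElliptic] [W.IsGloballyMinimal] [NeZero (W.conductorNorm ℤ)]
    (D : ModularParametrizationData W (W.conductorNorm ℤ)) {p : ℕ} (hp : p.Prime) (hp5 : 5 ≤ p) :
    padicValInt p D.maninConstant ≤ padicValNat p D.modularDegree :=
  h W D p hp (fun h2 ↦ by omega) (fun h3 ↦ by omega)

/-- From the valuation inequality to non-divisibility: if `val_p(c) ≤ val_p(deg)` and `p ∤ deg`
then `p ∤ c`, because `c ≠ 0` (`ModularParametrizationData.maninConstant_ne_zero_holds`).
[cite: CesnaviciusNeururerSaha2023, Thm. 1.2] -/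
theorem not_dvd_maninConstant_of_padicVal_le_of_not_dvd
    {W : WeierstrassCurve ℚ} {N : ℕ} [NeZero N] (D : ModularParametrizationData W N) {p : ℕ}
    (hp : p.Prime) (hle : padicValInt p D.maninConstant ≤ padicValNat p D.modularDegree)
    (hdeg : ¬ p ∣ D.modularDegree) : ¬ (p : ℤ) ∣ D.c := by
  haveI : Fact p.Prime := ⟨hp⟩
  intro hdvd
  have hc0 : D.c ≠ 0 := D.maninConstant_ne_zero_holds
  have h0 : padicValNat p D.modularDegree = 0 := padicValNat.eq_zero_of_not_dvd hdeg
  have hpos : 1 ≤ padicValInt p D.c := by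
    rcases (padicValInt_dvd_iff (p := p) 1 D.c).mp (by rwa [pow_one]) with h0' | h1
    · exact absurd h0' hc0
    · exact h1
  have : padicValInt p D.c ≤ 0 := by simpa [ModularParametrizationData.maninConstant, h0] using hle
  omega

/-- Corollary shape used by the cell (the Manin datum `p ∤ c(D)` of the Kolyvagin upper half from
the modular degree): under the fact, for a datum `D` of a globally minimal `W` at the conductor
level and a prime `p ≥ 5` NOT dividing the modular degree `D.deg`, `p ∤ D.c`.
[cite: CesnaviciusNeururerSaha2023, Thm. 1.2] -/
theorem not_dvd_maninConstant_of_not_dvd_modularDegree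
    (h : cesnaviciusNeururerSaha_padicVal_maninConstant_le_modularDegree)
    (W : WeierstrassCurve ℚ) [W.IsElliptic] [W.IsGloballyMinimal] [NeZero (W.conductorNorm ℤ)]
    (D : ModularParametrizationData W (W.conductorNorm ℤ)) {p : ℕ} (hp : p.Prime) (hp5 : 5 ≤ p)
    (hdeg : ¬ p ∣ D.modularDegree) : ¬ (p : ℤ) ∣ D.c :=
  not_dvd_maninConstant_of_padicVal_le_of_not_dvd D hp
    (padicVal_maninConstant_le_modularDegree_of_five_le h W D hp hp5) hdeg

/-- **The prime `3` outside the printed exceptional clause**: under the fact, for a datum `D` of a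
globally minimal `W` at the conductor level `N`, if `3³ ∤ N` or some prime `p' ≡ 2 (mod 3)`
divides `N`, and `3 ∤ deg(D)`, then `3 ∤ c(D)`. [cite: CesnaviciusNeururerSaha2023, Thm. 1.2] -/
theorem not_three_dvd_maninConstant_of_not_dvd_modularDegree
    (h : cesnaviciusNeururerSaha_padicVal_maninConstant_le_modularDegree)
    (W : WeierstrassCurve ℚ) [W.IsElliptic] [W.IsGloballyMinimal] [NeZero (W.conductorNorm ℤ)]
    (D : ModularParametrizationData W (W.conductorNorm ℤ))
    (hN : ¬ 3 ^ 3 ∣ W.conductorNorm ℤ ∨ ∃ q : ℕ, q.Prime ∧ q ∣ W.conductorNorm ℤ ∧ q % 3 = 2)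
    (hdeg : ¬ 3 ∣ D.modularDegree) : ¬ (3 : ℤ) ∣ D.c := by
  refine not_dvd_maninConstant_of_padicVal_le_of_not_dvd D Nat.prime_three
    (h W D 3 Nat.prime_three (fun h2 ↦ by omega) fun h3 ↦ ?_) hdeg
  rcases hN with h27 | ⟨q, hq, hqN, hq2⟩
  · exact h27 h3.2.1
  · exact h3.2.2 q hq hqN hq2

/-! ### Thm. 1.2 for `Γ = Γ₀(N)`, the FULL "more precisely" clause (all primes, with the `+1` rows)

The fact above transcribes only the row "`0` otherwise". The printed clause (§1, Thm. 1.2, display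
following "more precisely, for every prime `p`, we have") reads, verbatim:
`val_p(c_φ) ≤ val_p(deg(φ)) + {1 if p = 2 with val_2(N) ≥ 3 and there is no p' ∣ N with
p' ≡ 3 mod 4; 1 if p = 3 with val_3(N) ≥ 3 and there is no p' ∣ N with p' ≡ 2 mod 3; 0 otherwise}`,
and the two printed summaries preceding it: "every surjection `φ : (X_Γ)_ℚ ↠ E` satisfies
`c_φ ∣ 6 · deg(φ)`, and if `N` is cube-free that is, if `8 ∤ N` and `27 ∤ N`, then even
`c_φ ∣ deg(φ)`". Below: the printed correction term as a definition
(`cesnaviciusNeururerSahaCorrection`), the full clause at `Γ = Γ₀(N)` as a named fact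
(`cesnaviciusNeururerSaha_thm_1_2`), the bridge to the row-"`0` otherwise" fact above (proved), and
the two printed summaries as proved corollaries. Same rendering of "surjection `φ : X₀(N)_ℚ ↠ E`" by
parametrisation data of the globally minimal model at the conductor level as above (module
docstring: `c_{φ_D} = ±D.c`, `deg φ_D = D.deg`; conversely every `φ` with `φ(∞) = O` is `m_c ∘ π_f`
by Albanese functoriality and multiplicity one, and translations change neither `c_φ` nor `deg φ`,
so quantifying over data is quantifying over surjections). NOT transcribed (no tree vocabulary for
`X_Γ` over `ℤ_(p)` as a scheme): intermediate levels `Γ₁(N) ⊊ Γ ⊊ Γ₀(N)` and the final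
rational-singularity refinement "if for some `Γ ⊆ Γ' ⊆ Γ₀(N)` the singularities of
`(X_{Γ'})_{ℤ_(p)}` are rational, then `val_p(c_φ) ≤ val_p(deg(φ))`". -/

open Classical in
/-- **The printed correction term of ČNS Thm. 1.2** at level `N` and prime `p`:
`1` if `p = 2` with `val_2(N) ≥ 3` and there is no prime `p' ∣ N` with `p' ≡ 3 mod 4`; `1` if
`p = 3` with `val_3(N) ≥ 3` and there is no prime `p' ∣ N` with `p' ≡ 2 mod 3`; `0` otherwise
(`val_p(N) ≥ 3` ↦ `p³ ∣ N`; `p'` ranges over primes).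
[cite: CesnaviciusNeururerSaha2023, Thm. 1.2] -/
def cesnaviciusNeururerSahaCorrection (N p : ℕ) : ℕ :=
  if (p = 2 ∧ 2 ^ 3 ∣ N ∧ ∀ q : ℕ, q.Prime → q ∣ N → q % 4 ≠ 3) ∨
      (p = 3 ∧ 3 ^ 3 ∣ N ∧ ∀ q : ℕ, q.Prime → q ∣ N → q % 3 ≠ 2) then 1 else 0

/-- The correction term is at most `1`. [cite: CesnaviciusNeururerSaha2023, Thm. 1.2] -/
theorem cesnaviciusNeururerSahaCorrection_le_one (N p : ℕ) :
    cesnaviciusNeururerSahaCorrection N p ≤ 1 := by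
  unfold cesnaviciusNeururerSahaCorrection
  split_ifs <;> simp

/-- Outside the two printed exceptional clauses the correction term is `0` (the row
"`0` otherwise"). [cite: CesnaviciusNeururerSaha2023, Thm. 1.2] -/
theorem cesnaviciusNeururerSahaCorrection_eq_zero {N p : ℕ}
    (h2 : ¬ (p = 2 ∧ 2 ^ 3 ∣ N ∧ ∀ q : ℕ, q.Prime → q ∣ N → q % 4 ≠ 3))
    (h3 : ¬ (p = 3 ∧ 3 ^ 3 ∣ N ∧ ∀ q : ℕ, q.Prime → q ∣ N → q % 3 ≠ 2)) :
    cesnaviciusNeururerSahaCorrection N p = 0 := by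
  unfold cesnaviciusNeururerSahaCorrection
  rw [if_neg (not_or.mpr ⟨h2, h3⟩)]

/-- At a prime `p ≥ 5` the correction term is `0`. [cite: CesnaviciusNeururerSaha2023, Thm. 1.2] -/
theorem cesnaviciusNeururerSahaCorrection_eq_zero_of_five_le (N : ℕ) {p : ℕ} (hp5 : 5 ≤ p) :
    cesnaviciusNeururerSahaCorrection N p = 0 :=
  cesnaviciusNeururerSahaCorrection_eq_zero (fun h ↦ by omega) (fun h ↦ by omega)

/-- At a cube-free level (`8 ∤ N` and `27 ∤ N`) the correction term is `0` at every `p`.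
[cite: CesnaviciusNeururerSaha2023, Thm. 1.2] -/
theorem cesnaviciusNeururerSahaCorrection_eq_zero_of_cubefree {N : ℕ} (h8 : ¬ 8 ∣ N)
    (h27 : ¬ 27 ∣ N) (p : ℕ) : cesnaviciusNeururerSahaCorrection N p = 0 :=
  cesnaviciusNeururerSahaCorrection_eq_zero (fun h ↦ h8 (by simpa using h.2.1))
    (fun h ↦ h27 (by simpa using h.2.1))

/-- The correction term is bounded by `val_p(6)` at every prime `p` (it is `≤ 1` and vanishes unless
`p ∈ {2, 3}`); this is how the printed summary `c_φ ∣ 6 · deg(φ)` follows from the clause.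
[cite: CesnaviciusNeururerSaha2023, Thm. 1.2] -/
theorem cesnaviciusNeururerSahaCorrection_le_padicValNat_six (N : ℕ) {p : ℕ} (hp : p.Prime) :
    cesnaviciusNeururerSahaCorrection N p ≤ padicValNat p 6 := by
  haveI : Fact p.Prime := ⟨hp⟩
  unfold cesnaviciusNeururerSahaCorrection
  split_ifs with h
  · have h6 : padicValNat p 6 = padicValNat p 2 + padicValNat p 3 := by
      rw [show (6 : ℕ) = 2 * 3 from rfl]; exact padicValNat.mul (by norm_num) (by norm_num)
    rcases h with ⟨rfl, -⟩ | ⟨rfl, -⟩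
    · rw [h6, padicValNat_self]; omega
    · rw [h6, padicValNat_self]; omega
  · exact Nat.zero_le _

/-- **Česnavičius–Neururer–Saha 2024, Thm. 1.2 for `Γ = Γ₀(N)` — the full "more precisely" clause.**
Printed (JEMS 26 (2024) 573–637, Thm. 1.2; arXiv:1911.09446 §1, label `thm:main-result`): "For an
elliptic curve `E` over `ℚ` of conductor `N`, and for a level `Γ` with `Γ₁(N) ⊂ Γ ⊂ Γ₀(N)`, every
surjection `φ : (X_Γ)_ℚ ↠ E` satisfies `c_φ ∣ 6 · deg(φ)`, and if `N` is cube-free that is, if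
`8 ∤ N` and `27 ∤ N`, then even `c_φ ∣ deg(φ)`; more precisely, for every prime `p`, we have
`val_p(c_φ) ≤ val_p(deg(φ)) + {1 if p = 2 with val_2(N) ≥ 3 and there is no p' ∣ N with
p' ≡ 3 mod 4; 1 if p = 3 with val_3(N) ≥ 3 and there is no p' ∣ N with p' ≡ 2 mod 3; 0 otherwise}".
Rendering at `Γ = Γ₀(N)` (see the module docstring and the section header above): for every
globally minimal model `W/ℚ` of an elliptic curve, `N = W.conductorNorm ℤ`, every parametrisation
datum `D` of `W` at level `N` (so `φ_D : X₀(N)_ℚ ↠ E` over `ℚ`, `c_{φ_D} = ±D.c`,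
`deg φ_D = D.deg`; `D.c ∈ ℤ`, `D.c ≠ 0` are tree facts) and every prime `p`:
`val_p(D.c) ≤ val_p(D.deg) + ε_p(N)` with `ε_p(N) = cesnaviciusNeururerSahaCorrection N p` the
printed correction. Optimality is NOT assumed. FAITHFUL to print at `Γ = Γ₀(N)`; weaker than print
only in omitting the intermediate levels `Γ` and the rational-singularity refinement. It implies the
row-"`0` otherwise" fact `cesnaviciusNeururerSaha_padicVal_maninConstant_le_modularDegree`
(`…_of_thm_1_2` below). Named fact (statement only).
[cite: CesnaviciusNeururerSaha2023, Thm. 1.2] -/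
def cesnaviciusNeururerSaha_thm_1_2 : Prop :=
  ∀ (W : WeierstrassCurve ℚ) [W.IsElliptic] [W.IsGloballyMinimal] [NeZero (W.conductorNorm ℤ)]
    (D : ModularParametrizationData W (W.conductorNorm ℤ)) (p : ℕ), p.Prime →
    padicValInt p D.maninConstant ≤
      padicValNat p D.modularDegree + cesnaviciusNeururerSahaCorrection (W.conductorNorm ℤ) p

/-- **Bridge: the full clause implies the row-"`0` otherwise" fact** of this file (outside the two
exceptional clauses the correction term vanishes). [cite: CesnaviciusNeururerSaha2023, Thm. 1.2] -/
theorem cesnaviciusNeururerSaha_padicVal_maninConstant_le_modularDegree_of_thm_1_2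
    (h : cesnaviciusNeururerSaha_thm_1_2) :
    cesnaviciusNeururerSaha_padicVal_maninConstant_le_modularDegree := by
  intro W _ _ _ D p hp h2 h3
  have := h W D p hp
  rwa [cesnaviciusNeururerSahaCorrection_eq_zero h2 h3, add_zero] at this

/-- **The row at `p = 2`**: `val_2(c) ≤ val_2(deg) + 1` for every datum, unconditionally (the
correction term is `≤ 1`). [cite: CesnaviciusNeururerSaha2023, Thm. 1.2] -/
theorem padicValInt_maninConstant_le_modularDegree_add_one (h : cesnaviciusNeururerSaha_thm_1_2)
    (W : WeierstrassCurve ℚ) [W.IsElliptic] [W.IsGloballyMinimal] [NeZero (W.conductorNorm ℤ)]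
    (D : ModularParametrizationData W (W.conductorNorm ℤ)) {p : ℕ} (hp : p.Prime) :
    padicValInt p D.maninConstant ≤ padicValNat p D.modularDegree + 1 :=
  (h W D p hp).trans (by
    have := cesnaviciusNeururerSahaCorrection_le_one (W.conductorNorm ℤ) p
    omega)

/-- **The row at `p = 2` outside its exceptional clause**: if `8 ∤ N` or some prime `p' ≡ 3 (mod 4)`
divides `N`, then `val_2(c) ≤ val_2(deg)`. [cite: CesnaviciusNeururerSaha2023, Thm. 1.2] -/
theorem padicValInt_two_maninConstant_le_modularDegree (h : cesnaviciusNeururerSaha_thm_1_2)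
    (W : WeierstrassCurve ℚ) [W.IsElliptic] [W.IsGloballyMinimal] [NeZero (W.conductorNorm ℤ)]
    (D : ModularParametrizationData W (W.conductorNorm ℤ))
    (hN : ¬ 2 ^ 3 ∣ W.conductorNorm ℤ ∨ ∃ q : ℕ, q.Prime ∧ q ∣ W.conductorNorm ℤ ∧ q % 4 = 3) :
    padicValInt 2 D.maninConstant ≤ padicValNat 2 D.modularDegree := by
  have := h W D 2 Nat.prime_two
  rwa [cesnaviciusNeururerSahaCorrection_eq_zero (fun h2 ↦ ?_) (fun h3 ↦ by omega), add_zero]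
    at this
  rcases hN with h8 | ⟨q, hq, hqN, hq3⟩
  · exact h8 h2.2.1
  · exact h2.2.2 q hq hqN hq3

/-- **The row at `p = 3` outside its exceptional clause**: if `27 ∤ N` or some prime
`p' ≡ 2 (mod 3)` divides `N`, then `val_3(c) ≤ val_3(deg)`.
[cite: CesnaviciusNeururerSaha2023, Thm. 1.2] -/
theorem padicValInt_three_maninConstant_le_modularDegree (h : cesnaviciusNeururerSaha_thm_1_2)
    (W : WeierstrassCurve ℚ) [W.IsElliptic] [W.IsGloballyMinimal] [NeZero (W.conductorNorm ℤ)]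
    (D : ModularParametrizationData W (W.conductorNorm ℤ))
    (hN : ¬ 3 ^ 3 ∣ W.conductorNorm ℤ ∨ ∃ q : ℕ, q.Prime ∧ q ∣ W.conductorNorm ℤ ∧ q % 3 = 2) :
    padicValInt 3 D.maninConstant ≤ padicValNat 3 D.modularDegree := by
  have := h W D 3 Nat.prime_three
  rwa [cesnaviciusNeururerSahaCorrection_eq_zero (fun h2 ↦ by omega) (fun h3 ↦ ?_), add_zero]
    at this
  rcases hN with h27 | ⟨q, hq, hqN, hq2⟩
  · exact h27 h3.2.1
  · exact h3.2.2 q hq hqN hq2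

/-- From prime-by-prime valuation inequalities to divisibility: a non-zero integer `c` divides a
non-zero natural number `n` as soon as `val_p(c) ≤ val_p(n)` for every prime `p`
(Mathlib `Nat.dvd_iff_prime_pow_dvd_dvd`, `padicValNat_dvd_iff_le`). [folklore] -/
private theorem int_dvd_natCast_of_forall_padicValInt_le {c : ℤ} {n : ℕ} (hc : c ≠ 0)
    (hn : n ≠ 0) (h : ∀ p : ℕ, p.Prime → padicValInt p c ≤ padicValNat p n) : c ∣ (n : ℤ) := by
  rw [Int.dvd_natCast, Nat.dvd_iff_prime_pow_dvd_dvd]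
  intro p k hp hpk
  haveI : Fact p.Prime := ⟨hp⟩
  rw [padicValNat_dvd_iff_le (Int.natAbs_ne_zero.mpr hc)] at hpk
  rw [padicValNat_dvd_iff_le hn]
  exact hpk.trans (h p hp)

/-- **The printed summary `c_φ ∣ 6 · deg(φ)`** (ČNS Thm. 1.2, first display) at `Γ = Γ₀(N)`: under
the fact, for every datum `D` of a globally minimal `W` at the conductor level, `D.c ∣ 6 · D.deg`.
Proof as in print: prime by prime, `val_p(c) ≤ val_p(deg) + ε_p(N) ≤ val_p(deg) + val_p(6)
= val_p(6 · deg)` (`D.c ≠ 0` is `maninConstant_ne_zero_holds`, `D.deg > 0` is `deg_pos`).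
[cite: CesnaviciusNeururerSaha2023, Thm. 1.2] -/
theorem maninConstant_dvd_six_mul_modularDegree (h : cesnaviciusNeururerSaha_thm_1_2)
    (W : WeierstrassCurve ℚ) [W.IsElliptic] [W.IsGloballyMinimal] [NeZero (W.conductorNorm ℤ)]
    (D : ModularParametrizationData W (W.conductorNorm ℤ)) :
    D.maninConstant ∣ ((6 * D.modularDegree : ℕ) : ℤ) := by
  refine int_dvd_natCast_of_forall_padicValInt_le D.maninConstant_ne_zero_holds
    (Nat.mul_ne_zero (by norm_num) D.deg_pos.ne') fun p hp ↦ ?_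
  haveI : Fact p.Prime := ⟨hp⟩
  have hdeg : D.modularDegree ≠ 0 := D.deg_pos.ne'
  rw [padicValNat.mul (by norm_num) hdeg, add_comm]
  exact (h W D p hp).trans (Nat.add_le_add_left
    (cesnaviciusNeururerSahaCorrection_le_padicValNat_six _ hp) _)

/-- **The printed cube-free summary `c_φ ∣ deg(φ)`** (ČNS Thm. 1.2: "if `N` is cube-free that is, if
`8 ∤ N` and `27 ∤ N`, then even `c_φ ∣ deg(φ)`") at `Γ = Γ₀(N)`: under the fact, for every datum
`D` of a globally minimal `W` at a conductor level `N` with `8 ∤ N` and `27 ∤ N`, `D.c ∣ D.deg`.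
[cite: CesnaviciusNeururerSaha2023, Thm. 1.2] -/
theorem maninConstant_dvd_modularDegree_of_cubefree (h : cesnaviciusNeururerSaha_thm_1_2)
    (W : WeierstrassCurve ℚ) [W.IsElliptic] [W.IsGloballyMinimal] [NeZero (W.conductorNorm ℤ)]
    (D : ModularParametrizationData W (W.conductorNorm ℤ)) (h8 : ¬ 8 ∣ W.conductorNorm ℤ)
    (h27 : ¬ 27 ∣ W.conductorNorm ℤ) :
    D.maninConstant ∣ (D.modularDegree : ℤ) := by
  refine int_dvd_natCast_of_forall_padicValInt_le D.maninConstant_ne_zero_holds D.deg_pos.ne'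
    fun p hp ↦ ?_
  have := h W D p hp
  rwa [cesnaviciusNeururerSahaCorrection_eq_zero_of_cubefree h8 h27, add_zero] at this

/-- **Corollary shape for the cells at `p ∈ {2, 3}`** (the Manin datum `p ∤ c(D)` from the modular
degree, now also at `2`): under the fact, for a datum `D` of a globally minimal `W` at a CUBE-FREE
conductor level and any `p : ℕ` (a prime, in the application) with `p ∤ D.deg`, `p ∤ D.c`.
[cite: CesnaviciusNeururerSaha2023, Thm. 1.2] -/
theorem not_dvd_maninConstant_of_cubefree_of_not_dvd_modularDegree
    (h : cesnaviciusNeururerSaha_thm_1_2)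
    (W : WeierstrassCurve ℚ) [W.IsElliptic] [W.IsGloballyMinimal] [NeZero (W.conductorNorm ℤ)]
    (D : ModularParametrizationData W (W.conductorNorm ℤ)) (h8 : ¬ 8 ∣ W.conductorNorm ℤ)
    (h27 : ¬ 27 ∣ W.conductorNorm ℤ) {p : ℕ} (hdeg : ¬ p ∣ D.modularDegree) :
    ¬ (p : ℤ) ∣ D.c := fun hpc ↦
  hdeg (Int.natCast_dvd_natCast.mp
    (hpc.trans (maninConstant_dvd_modularDegree_of_cubefree h W D h8 h27)))

end Literature.NumberTheory.EllipticCurves.ModularForms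

end
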